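import Literature.NumberTheory.PAdicHodge.AinfRamifiedOmegaPeriodHom
import Literature.NumberTheory.PAdicHodge.AinfRamifiedEtaPeriodBounded
import Literature.NumberTheory.PAdicHodge.AinfRamifiedEtaPeriodAdd
import Literature.NumberTheory.PAdicHodge.AinfRamifiedEtaPeriodTheta
import HarnessLib

/-!
# The η-period `∫η : T_pŴ♭(𝒪_{ℂ_F}) → B_dR⁺(F)` over the ramified base as a `ℤ_p`-linear `Γ_F`-equivariant homomorphism,
# transverse to `Fil¹`

Topic `Literature/NumberTheory/PAdicHodge`; namespace `Literature.NumberTheory.PAdicHodge.AinfRamTop`. The ramified twin of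
`AinfWeierstrassEtaPeriodHom` + `AinfWeierstrassPeriodsLinear` §2 (η-part): for `W` over the discrete copy `CoeffDisc D` of
`𝒪_D = ℤ_p[ϖ]`, a bridge `ψ : 𝒪_D → 𝒪_F` compatible with `𝒪_D → F`, and `W♭ = W ⊗_ψ 𝒪_F`:

* **`etaPeriodHomO W ψ hθ hψ : TatePtO F W♭ p →+ BdRPlusTop F p`, `τ ↦ ∫_τ η`** — additive by `etaPeriod_addSeq`
  (file `AinfRamifiedEtaPeriodAdd`) read through `seqO_add_eq_addSeq` (file `AinfRamifiedTateModule`);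
* `etaPeriodHomO_apply`, **`gal_etaPeriodHomO`** (`σ(∫_τ η) = ∫_{σ•τ} η`), `etaPeriodHomO_zsmul`, `etaPeriodHomO_bounded`
  (`k!·∫η ∈ ι_𝒪(A_inf(𝒪)) + Fil^k`, file `AinfRamifiedEtaPeriodBounded`);
* **`etaPeriodHomO_smul : ∫_{a•τ} η = ι(a)·∫_τ η` for `a ∈ ℤ_p`** (`AinfRam.map_smul_eq_of_bounded`) and `etaPeriodHomO_smul'`
  (scalar through `ℚ_p → B_dR⁺`, the hypothesis `hφ₂s` of the socket `DeRhamOfTatePtOPeriods`);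
* **`etaPeriodHomO_not_mem_filOne`**: `R_p(τ₁) ∉ p𝒪_{ℂ_F} ⇒ ∫_τ η ∉ Fil¹ B_dR⁺` (file `AinfRamifiedEtaPeriodTheta`), and
  `etaPeriodHomO_ne_mul_omegaPeriodHomO` (independence of the two periods at a transverse point).

So `φ₂ := etaPeriodHomO` discharges `hφ₂s`, `hφ₂g`, `hNη` of `isDeRham_restrictedRationalTateRep_of_explicitModel_of_etaHom`
(file `DeRhamSupersingularRamifiedOfEtaHom`). BSD route EdixhovenFibreFiveSeven, crux K★ `stmt-BirchSwinnertonDyer-22226`, road (R1).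
BSD / K★ are not proved by any of this.

## References
* P. Colmez, *Périodes p-adiques des variétés abéliennes*, Math. Ann. 292 (1992), §2. [Colmez1992PeriodesAbeliennes]
* J.-M. Fontaine, *Le corps des périodes p-adiques*, Astérisque 223 (1994), Exp. II §1.5.3–1.5.5. [FontaineAsterisque223III]
-/

noncomputable section

open Ideal Filter Topology Field WittVector MvPowerSeries ValuativeRel

namespace Literature.NumberTheory.PAdicHodge

open Literature.NumberTheory.GaloisRepresentations
open Literature.NumberTheory.GaloisRepresentations.IsNonarchimedeanLocalField
open Literature.NumberTheory.GaloisRepresentations.LubinTate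
open Literature.NumberTheory.EllipticCurves

namespace AinfRamTop

variable {F : Type} [Field F] [ValuativeRel F] [TopologicalSpace F] [IsNonarchimedeanLocalField F] [CharZero F]
  {p : ℕ} [Fact p.Prime] [Fact (¬ IsUnit (p : integerC F))] [IsAdicComplete (Ideal.span {(p : integerC F)}) (integerC F)]
  {hp : valuation F p < 1} {D : EisensteinRoot F p hp}
  (W : WeierstrassCurve (EisensteinRoot.CoeffDisc D)) (ψ : EisensteinRoot.CoeffDisc D →+* LTCoeff F)
  {hθ : Function.Surjective (fontaineTheta (integerC F) p)}
  {hψ : ∀ c, algebraMap (LTCoeff F) F (ψ c) = EisensteinRoot.CoeffDisc.toF D c}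

/-- Congruence for `etaPeriod` in the sequence. [cite: Colmez1992PeriodesAbeliennes, §2] -/
theorem etaPeriod_congr_seq {t t' : ℕ → (maxNilIdealC F).toIdeal} (h : t = t')
    (ht0 : (t 0 : CBall F) = 0) (htp : ∀ n, mulPC W (t (n + 1)) = t n)
    (ht0' : (t' 0 : CBall F) = 0) (htp' : ∀ n, mulPC W (t' (n + 1)) = t' n) :
    etaPeriod W hθ t ht0 htp = etaPeriod W hθ t' ht0' htp' := by subst h; rfl

variable (hθ hψ) in
/-- **The η-period as a homomorphism `T_pŴ♭(𝒪_{ℂ_F}) →+ B_dR⁺(F)`, `τ ↦ ∫_τ η`**, `W♭ = W ⊗_ψ 𝒪_F` (additive by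
`etaPeriod_addSeq` over `A_inf(𝒪)`). [cite: Colmez1992PeriodesAbeliennes, §2] -/
def etaPeriodHomO : AinfTop.TatePtO F (W.map ψ) p →+ BdRPlusTop F p :=
  AddMonoidHom.mk' (fun τ => etaPeriod W hθ (AinfTop.seqO (W.map ψ) τ) (AinfTop.seqO_zero _ τ) (mulPC_seqO W ψ hψ τ))
    fun τ τ' =>
    (etaPeriod_congr_seq W (seqO_add_eq_addSeq W ψ hψ τ τ') _ _
      (coe_addSeq_zero W (AinfTop.seqO_zero _ τ) (AinfTop.seqO_zero _ τ'))
      (mulPC_addSeq W (mulPC_seqO W ψ hψ τ) (mulPC_seqO W ψ hψ τ'))).trans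
      (etaPeriod_addSeq W (hθ := hθ) (AinfTop.seqO_zero _ τ) (AinfTop.seqO_zero _ τ') (mulPC_seqO W ψ hψ τ)
        (mulPC_seqO W ψ hψ τ'))

/-- Unfolding `etaPeriodHomO`. [cite: Colmez1992PeriodesAbeliennes, §2] -/
theorem etaPeriodHomO_apply (τ : AinfTop.TatePtO F (W.map ψ) p) :
    etaPeriodHomO W ψ hθ hψ τ = etaPeriod W hθ (AinfTop.seqO (W.map ψ) τ) (AinfTop.seqO_zero _ τ) (mulPC_seqO W ψ hψ τ) := rfl

/-- **`Γ_F`-equivariance of the η-period: `σ(∫_τ η) = ∫_{σ•τ} η`.** [cite: Colmez1992PeriodesAbeliennes, §2]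
[cite: FontaineAsterisque223III, Exp. II §1.5.4] -/
theorem gal_etaPeriodHomO (σ : absoluteGaloisGroup F) (τ : AinfTop.TatePtO F (W.map ψ) p) :
    BdRPlusTop.gal F p σ (etaPeriodHomO W ψ hθ hψ τ) = etaPeriodHomO W ψ hθ hψ (σ • τ) := by
  rw [etaPeriodHomO_apply, etaPeriodHomO_apply, gal_etaPeriod W σ (AinfTop.seqO_zero _ τ) (mulPC_seqO W ψ hψ τ)]
  exact etaPeriod_congr_seq W (AinfTop.seqO_smul _ σ τ).symm _ _ _ _

/-- **The η-period is `ℤ`-linear**: `∫_{n•τ} η = n • ∫_τ η`. [cite: Colmez1992PeriodesAbeliennes, §2] -/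
theorem etaPeriodHomO_zsmul (n : ℤ) (τ : AinfTop.TatePtO F (W.map ψ) p) :
    etaPeriodHomO W ψ hθ hψ (n • τ) = n • etaPeriodHomO W ψ hθ hψ τ :=
  map_zsmul _ n τ

/-- **`k!·∫_τ η ∈ ι_𝒪(A_inf(𝒪)) + Fil^k B_dR⁺`** uniformly in `τ` (`etaPeriod_bounded` read on `TatePtO`).
[cite: FontaineAsterisque223III, Exp. II §1.5.3] -/
theorem etaPeriodHomO_bounded (k : ℕ) (τ : AinfTop.TatePtO F (W.map ψ) p) :
    ∃ (b : AinfRam D) (w : BdRPlusTop F p),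
      ((k.factorial : ℤ) : BdRPlusTop F p) * etaPeriodHomO W ψ hθ hψ τ =
        BdRPlusTop.of F p (AinfRam.toBdR D hθ b) + BdRPlusTop.of F p xiBdR ^ k * w :=
  etaPeriod_bounded W k (AinfTop.seqO_zero _ τ) (mulPC_seqO W ψ hψ τ)

/-- **`ℤ_p`-linearity of the η-period over the ramified base: `∫_{a•τ} η = ι(a)·∫_τ η`** (`a ∈ ℤ_p`).
[cite: Colmez1992PeriodesAbeliennes, §2] [cite: FontaineAsterisque223III, Exp. II §1.5.4] -/
theorem etaPeriodHomO_smul (a : ℤ_[p]) (τ : AinfTop.TatePtO F (W.map ψ) p) :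
    etaPeriodHomO W ψ hθ hψ (a • τ) = BdRPlusTop.ofAinf F p (zpToAinf a) * etaPeriodHomO W ψ hθ hψ τ :=
  AinfRam.map_smul_eq_of_bounded D hθ (etaPeriodHomO W ψ hθ hψ)
    (fun k => ⟨(k.factorial : ℤ), by exact_mod_cast k.factorial_ne_zero, fun τ' => etaPeriodHomO_bounded W ψ k τ'⟩) a τ

/-- The same with the scalar read through `ℚ_p → B_dR⁺` — the hypothesis `hφ₂s` of the socket. [cite: Colmez1992PeriodesAbeliennes, §2] -/
theorem etaPeriodHomO_smul' (a : ℤ_[p]) (τ : AinfTop.TatePtO F (W.map ψ) p) :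
    etaPeriodHomO W ψ hθ hψ (a • τ) = BdRPlusTop.of F p (qpToBdR (a : ℚ_[p])) * etaPeriodHomO W ψ hθ hψ τ := by
  rw [etaPeriodHomO_smul, qpToBdR_coe]
  rfl

/-- **`R_p(τ₁) ∉ p𝒪_{ℂ_F} ⇒ ∫_τ η ∉ Fil¹ B_dR⁺`** (contrast `omegaPeriodHomO_mem_filOne : ∫_τ ω ∈ Fil¹`).
[cite: Colmez1992PeriodesAbeliennes, §2] -/
theorem etaPeriodHomO_not_mem_filOne (τ : AinfTop.TatePtO F (W.map ψ) p)
    (h₁ : mulDefectC hθ W (AinfTop.seqO (W.map ψ) τ 1) ∉ Ideal.span {(p : CBall F)}) :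
    etaPeriodHomO W ψ hθ hψ τ ∉ (BdRPlusTop.filOne F p).toIdeal :=
  etaPeriod_not_mem_filOne W (AinfTop.seqO_zero _ τ) (mulPC_seqO W ψ hψ τ) h₁

/-- **Independence of the two periods at a transverse point**: if `R_p(τ₁) ∉ p𝒪_{ℂ_F}` then no `b ∈ B_dR⁺` has
`∫_τ η = b · ∫_τ ω`. [cite: Colmez1992PeriodesAbeliennes, §2] -/
theorem etaPeriodHomO_ne_mul_omegaPeriodHomO (τ : AinfTop.TatePtO F (W.map ψ) p)
    (h₁ : mulDefectC hθ W (AinfTop.seqO (W.map ψ) τ 1) ∉ Ideal.span {(p : CBall F)}) (b : BdRPlusTop F p) :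
    etaPeriodHomO W ψ hθ hψ τ ≠ b * omegaPeriodHomO W ψ hθ hψ τ := fun h =>
  etaPeriodHomO_not_mem_filOne W ψ τ h₁ (h ▸ Ideal.mul_mem_left _ b (omegaPeriodHomO_mem_filOne W ψ τ))

end AinfRamTop

end Literature.NumberTheory.PAdicHodge

end
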